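import Literature.MathematicalPhysics.QuantumFieldTheory.Balaban1983to89.B10SectCExpansion

/-!
# F-idea1-g16-1 — two-run `(43)×(44)` LEG-CURRENCY bookkeeping (door (ii) of F-idea1-g15-1)

Crux `stmt-QuantumFields-19201` (`…Theses.UnitScaleTilt.FluctuationComparisonRegPr`), feeding the registered stub
`stub_globalTwoRunSlackFam` (3⁗, VERBATIM by owner ruling g22-№3) of `stmt-QuantumFields-19935`.  Ideator 1, round 16.
SKETCH ONLY: hypothesis-shaped rows + certified real/multilinear algebra; 0 `sorry`; imports one OLD Literature module.

## The finding (F-idea1-g16-1)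

g15 erratum (F-idea1-g15-1): for the `g`-free Λ-born family (CMP 102 p.265 L13–15; tree G3D-07 `LogZLocalizedAsCited`,
`far_le` at `g^7 (r p)^7`) the landed F7 chart rows `CfgSizeΦ … p₀`, `KernelSizeΦ`, `RemainderSmallΦ … p₀` are NOT
displayed-dischargeable in SUP-NORM chart currency: a `g`-free activity's Lipschitz constant on the small-field ball of
radius `θ·collarW` carries the collar polylog and no spare `g`, while 3⁗ wants `C` uniform in `K, n`, profile `p₀`,
`σ ∈ ℕ, σ ≥ 7`.  Door (ii): compare the Λ family in PRINT's currency — the multilinear LEG representation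
(43) `𝒫_j(Y_j, U_k) = ⟨𝒫_j(Y_j), B_k(c₁), …, B_k(c_n)⟩, n ≥ 2` with the DISTANCE form (28)/(44) of the loop-variable
bound `|B_k(c)| ≤ (ℓ⁻¹|c₋ − y|)·8L²B₃ g p(g) ℓ²` (tree `B10SectCExpansion.Bound44`; G3D-08 docstring: this distance form
is what makes print's (45) polylog-free).

TYPED HERE (abstract vertex geometry `X`, loop variables valued in a real normed space `E` — `su(2)` in the target):
* rows `Shape43M` (op-norm form of (43), both runs), `Loop44` (distance form of (28)/(44), both runs),
  `Shape43CauchyM` (two-run closeness of the COEFFICIENT MAPS at rate `δ`: the K1a-leg row) and `Loop44Cauchy`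
  (two-run closeness of the LOOP VARIABLES at rate `δB`, distance form: the 19200-side row);
* `bound44_twoRun`: the rows ⇒ the DIFFERENCE family `𝒫'_j(Y_j,U'_k) − 𝒫_j(Y_j,U_k)` obeys `Bound44` with
  `B₃ ↦ 2B₃` and constant `C·(δ + δB)` — by Mathlib's multilinear telescoping
  `ContinuousMultilinearMap.norm_image_sub_le'` (one leg differenced, the other `n − 1` legs at full size, so the
  `n ≥ 2` legs still supply `(g p(g))²`; the leg count `n ≤ 2ⁿ` is absorbed into `B₃ ↦ 2B₃`);
* `bound45_twoRun`, `bound46_twoRun`: then (45) and (46) BY NAME (`bound45_of_bound44`, `bound46_of_bound45`):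
  `Σ_{Y_j : y = y₀} |𝒫' − 𝒫| ≤ 2C(δ+δB)·(16L²B₃Z·g p(g))²·ℓ⁴` per block and
  `Σ_j Σ_y … ≤ 2C(δ+δB)·(16L²B₃Z)²M₁⁻³(L/(L−1))·(g p(g))²·|Λ_k|` in a region —
  i.e. RATE × θ₀² × VOLUME at PROFILE `p₀` with NO polylog and NO slack: exactly the rate half
  `C·|T_n|·θBal(n)²·L^{−a(K−n)}` of `GlobalSupRateTSlack` (3⁗ verbatim), once `δ + δB = O(L^{−a(K−n)})`;
* `twoRun_rate_add_slack`: orders `> N` are NOT compared — each run's remainder is SIZED by (57)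
  (`(g p(g))⁷`, profile `p₀`) and enters by the triangle inequality: the slack half `θ₀^σ`, `σ = 7 ∈ ℕ` ✓.
Consequence for the lane: in leg currency the Λ family needs NO spare `g` anywhere — the kernel rows are `O(1)` and
`g`-free exactly as printed, the `(g p(g))²` comes from the `n ≥ 2` legs, and the K1a-Λ row `Shape43CauchyM` is a
pure-rate statement (`δ = C_E·L^{−a(K−n)}`: interior excision of the coefficient maps, E-INT pack /
`T3InteriorExcision`), while `Loop44Cauchy` is the distance-form twin of the chart row `CfgCauchyΦ` (from the 19200-side
two-run plaquette closeness by the (28) ladder, cf. `B10Eq27AxialLog.norm_B27_le`).  The Ψ family keeps the landed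
sup-norm chain (spare `g`, g14 rescaling); rows add in the term function.

Dictionary to 3⁗: `g·pg ↔ θBal F.L γ b₀ p₀ n` (profile `p₀`: `pg = pFun b₀ p₀ g`), `ℓ = L^jη ↔ L^{−(k−j)}`,
`δ + δB ↔ (C_Λ + C_B)·((F.L:ℝ)^(K−n))⁻¹ ^ a`, `|Λ_k| ↔ card (Site (F.P n) 0)`, `Z`, smallness
`16L²B₃Z·g p(g)·ℓ² ≤ ½ ↔` a `γ`-window of the `window_oldSlice` type (F7 `K1aChartLine`).

Sources: Balaban, CMP 102 (1985) (43)–(46) pp.266–267, (57) p.270, p.265 L13–16 [Balaban1985UV3]; tree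
`B10SectCExpansion` (`Shape43`, `Bound44`, `factor44`, `blockSum45`, `bound45_of_bound44`, `bound46_of_bound45`),
G3D-07/G3D-08 (`Balaban1985CMP102/Binders*.lean`); Mathlib `ContinuousMultilinearMap.norm_image_sub_le'`.
presearch: two-run / Cauchy twin of `Bound44` in tree → none (`lean search 'Bound44' --decl`: Literature def + one-run
lemmas only); corpus/galaxy "multilinear telescoping polymer activities two cutoffs" → none specific (standard device).
-/

namespace Summit.QuantumFields.YangMills.Cruxes.FluctuationComparisonRegPr.Ideate1LegCurrency

open Literature.MathematicalPhysics.QuantumFieldTheory.Balaban1983to89.B10SectCExpansion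
open Finset

noncomputable section

variable {E : Type*} [NormedAddCommGroup E] [NormedSpace ℝ E]

/-! ## §1 The leg representation (43): coefficient maps and loop variables -/

/-- The multilinear COEFFICIENTS `𝒫_j(Y_j)` of (43) p.266, `Y_j = (y, c₁, …, c_n)`: for each block `y`, degree `n`
and bond tuple `c`, a continuous `n`-linear real form on the loop-variable space `E` (`= su(2)`).
[cite: Balaban1985UV3, (43) p.266] -/
abbrev CoeffMaps (X : VertexGeometry) (E : Type*) [NormedAddCommGroup E] [NormedSpace ℝ E] : Type _ :=
  X.Site → (n : ℕ) → (Fin n → X.Bond) → ContinuousMultilinearMap ℝ (fun _ : Fin n => E) ℝ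

/-- The LOOP VARIABLES `B_k(c) = (1/i) log Ū_k^j(Γ_{y,c₋} ∪ c ∪ Γ_{c₊,y})` of (43) (relative to the block `y`
through the contour `Γ_{y,·}`), valued in `E`. [cite: Balaban1985UV3, (43) p.266, (27)–(28) p.262] -/
abbrev LoopVars (X : VertexGeometry) (E : Type*) : Type _ := X.Site → X.Bond → E

/-- The EVALUATED TERM of (43): `𝒫_j(Y_j, U_k) = ⟨𝒫_j(Y_j), B_k(c₁), …, B_k(c_n)⟩`. -/
def evalTerm (X : VertexGeometry) (f : CoeffMaps X E) (B : LoopVars X E) : TermSizes X :=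
  fun y n c => f y n c (fun i => B y (c i))

/-- The decay weight of (43) attached to one leg: `exp(−κ₁(M₁ℓ)⁻¹|c₋ − y|)`. -/
def legDecay (X : VertexGeometry) (κ₁ M₁ ℓ : ℝ) (y : X.Site) (b : X.Bond) : ℝ :=
  Real.exp (-(κ₁ * (M₁ * ℓ)⁻¹ * X.dist (X.cminus b) y))

/-- The distance-form loop-variable size of (28)/(44) attached to one leg: `(ℓ⁻¹|c₋ − y|)·(8L²B₃ g p(g) ℓ²)`. -/
def legSize (X : VertexGeometry) (ℓ L B₃ g pg : ℝ) (y : X.Site) (b : X.Bond) : ℝ :=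
  (ℓ⁻¹ * X.dist (X.cminus b) y) * (8 * L ^ 2 * B₃ * g * pg * ℓ ^ 2)

theorem legDecay_pos (X : VertexGeometry) (κ₁ M₁ ℓ : ℝ) (y : X.Site) (b : X.Bond) :
    0 < legDecay X κ₁ M₁ ℓ y b := Real.exp_pos _

theorem legSize_nonneg (X : VertexGeometry) {ℓ L B₃ g pg : ℝ} (hℓ : 0 < ℓ) (hB : 0 ≤ B₃) (hg : 0 ≤ g)
    (hpg : 0 ≤ pg) (hdist : ∀ x y, 0 ≤ X.dist x y) (y : X.Site) (b : X.Bond) :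
    0 ≤ legSize X ℓ L B₃ g pg y b := by
  unfold legSize
  have h1 : 0 ≤ ℓ⁻¹ * X.dist (X.cminus b) y := mul_nonneg (inv_nonneg.mpr hℓ.le) (hdist _ _)
  have h2 : 0 ≤ 8 * L ^ 2 * B₃ * g * pg * ℓ ^ 2 := by positivity
  exact mul_nonneg h1 h2

/-- `factor44 = legDecay · legSize` (definitional). -/
theorem factor44_eq (X : VertexGeometry) (κ₁ M₁ ℓ L B₃ g pg : ℝ) (y : X.Site) (b : X.Bond) :
    factor44 X κ₁ M₁ ℓ L B₃ g pg y b = legDecay X κ₁ M₁ ℓ y b * legSize X ℓ L B₃ g pg y b := rfl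

/-- Doubling `B₃` doubles the (44) factor: the leg count `n ≤ 2ⁿ` is absorbed this way. -/
theorem factor44_two_mul (X : VertexGeometry) (κ₁ M₁ ℓ L B₃ g pg : ℝ) (y : X.Site) (b : X.Bond) :
    factor44 X κ₁ M₁ ℓ L (2 * B₃) g pg y b = 2 * factor44 X κ₁ M₁ ℓ L B₃ g pg y b := by
  unfold factor44; ring

/-! ## §2 The rows (hypothesis schemas — never asserted) -/

/-- ROW (43), op-norm form, ONE run: degree floor `n ≥ 2` and `‖𝒫_j(Y_j)‖ ≤ C·Π_i exp(−κ₁(M₁ℓ)⁻¹|c_{i,−} − y|)`.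
For the Λ-born family `C = O(1)` is `g`-FREE (CMP 102 p.265 L13–15; G3D-07) — harmless in this currency.
[cite: Balaban1985UV3, (43) p.266] -/
def Shape43M (X : VertexGeometry) (f : CoeffMaps X E) (κ₁ M₁ ℓ C : ℝ) : Prop :=
  (∀ (y : X.Site) (n : ℕ) (c : Fin n → X.Bond), f y n c ≠ 0 → 2 ≤ n) ∧
    ∀ (y : X.Site) (n : ℕ) (c : Fin n → X.Bond), ‖f y n c‖ ≤ C * ∏ i, legDecay X κ₁ M₁ ℓ y (c i)

/-- ROW (28)/(44), distance form, ONE run: `‖B_k(c)‖ ≤ (ℓ⁻¹|c₋ − y|)·8L²B₃ g p(g) ℓ²` (the axial ladder (28) times the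
run's plaquette small-field bound `|Ū(∂p) − 1| < 4L²B₃ g p(g)(L^jη)²`, profile `p = p₀` from the history tail).
[cite: Balaban1985UV3, (28) p.262, (44) p.267] -/
def Loop44 (X : VertexGeometry) (B : LoopVars X E) (ℓ L B₃ g pg : ℝ) : Prop :=
  ∀ (y : X.Site) (b : X.Bond), ‖B y b‖ ≤ legSize X ℓ L B₃ g pg y b

/-- ROW K1a-LEG (two runs, UNPRINTED core in this currency): the coefficient maps of the two runs are close at RATE `δ`
in op-norm with the same leg decay, `‖𝒫'_j(Y_j) − 𝒫_j(Y_j)‖ ≤ C·δ·Π_i exp(…)`.  For the Λ family: a pure-rate, `g`-free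
statement (interior excision of the maps' propagator content; `δ = C_E L^{−a(K−n)}`). -/
def Shape43CauchyM (X : VertexGeometry) (f f' : CoeffMaps X E) (κ₁ M₁ ℓ C δ : ℝ) : Prop :=
  ∀ (y : X.Site) (n : ℕ) (c : Fin n → X.Bond), ‖f' y n c - f y n c‖ ≤ C * δ * ∏ i, legDecay X κ₁ M₁ ℓ y (c i)

/-- ROW 19200-LEG (two runs, distance form): the loop variables of the two runs are close at RATE `δB` in units of the
one-run size, `‖B'_k(c) − B_k(c)‖ ≤ δB·(ℓ⁻¹|c₋ − y|)·8L²B₃ g p(g) ℓ²` (from two-run plaquette closeness by the (28)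
ladder) — the distance-form twin of the chart row `CfgCauchyΦ`. -/
def Loop44Cauchy (X : VertexGeometry) (B B' : LoopVars X E) (ℓ L B₃ g pg δB : ℝ) : Prop :=
  ∀ (y : X.Site) (b : X.Bond), ‖B' y b - B y b‖ ≤ δB * legSize X ℓ L B₃ g pg y b

/-! ## §3 One run: (43) op-norm + (44)-legs ⇒ `Bound44` (sanity; by name of `bound44_of_shape43`) -/

theorem bound44_of_shape43M (X : VertexGeometry) (f : CoeffMaps X E) (B : LoopVars X E)
    {κ₁ M₁ ℓ L B₃ g pg C : ℝ} (hC : 0 ≤ C) (h43 : Shape43M X f κ₁ M₁ ℓ C) (h44 : Loop44 X B ℓ L B₃ g pg) :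
    Bound44 X (evalTerm X f B) κ₁ M₁ ℓ L B₃ g pg C := by
  refine bound44_of_shape43 X (fun y n c => ‖f y n c‖) (evalTerm X f B) (fun y b => ‖B y b‖) hC ?_ ?_ ?_ ?_
  · refine ⟨fun y n c hP => h43.1 y n c fun hf => hP ?_, fun y n c => ?_⟩
    · show ‖f y n c‖ = 0
      rw [hf, norm_zero]
    · show |‖f y n c‖| ≤ _
      rw [abs_of_nonneg (norm_nonneg _)]
      exact h43.2 y n c
  · exact fun y b => norm_nonneg _
  · exact fun y b => h44 y b
  · intro y n c
    show |f y n c (fun i => B y (c i))| ≤ |‖f y n c‖| * ∏ i, ‖B y (c i)‖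
    rw [abs_of_nonneg (norm_nonneg _), ← Real.norm_eq_abs]
    exact (f y n c).le_opNorm _

/-! ## §4 Two runs: the multilinear telescoping ⇒ `Bound44` for the DIFFERENCE family -/

/-- Leg count absorbed: `δ + n·δB ≤ 2ⁿ·(δ + δB)` for `δ, δB ≥ 0`. -/
theorem rate_legCount_le (n : ℕ) {δ δB : ℝ} (hδ : 0 ≤ δ) (hδB : 0 ≤ δB) :
    δ + n * δB ≤ 2 ^ n * (δ + δB) := by
  have h1 : (1 : ℝ) ≤ 2 ^ n := by exact_mod_cast Nat.one_le_two_pow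
  have h2 : (n : ℝ) ≤ 2 ^ n := by exact_mod_cast (Nat.lt_two_pow_self).le
  nlinarith

/-- **Two-run (44).**  Rows: (43) op-norm for both runs' coefficient maps (floor + decay, constant `C`), K1a-leg
closeness at rate `δ`, (44)-legs for both runs' loop variables, 19200-leg closeness at rate `δB`.  Conclusion: the
difference family `𝒫'_j(Y_j, U'_k) − 𝒫_j(Y_j, U_k)` obeys (44) with `B₃ ↦ 2B₃` and constant `C·(δ + δB)`.
Proof: `F'm' − Fm = (F' − F)m' + (Fm' − Fm)`; the first term by the op-norm, the second by Mathlib's telescoping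
`ContinuousMultilinearMap.norm_image_sub_le'` (one leg differenced at `δB·legSize`, the others at `legSize`), then
`δ + nδB ≤ 2ⁿ(δ + δB)` and `Π(2·factor44) = Π factor44(2B₃)`. -/
theorem bound44_twoRun (X : VertexGeometry) (f f' : CoeffMaps X E) (B B' : LoopVars X E)
    {κ₁ M₁ ℓ L B₃ g pg C δ δB : ℝ} (hC : 0 ≤ C) (hδ : 0 ≤ δ) (hδB : 0 ≤ δB) (hℓ : 0 < ℓ) (hB : 0 ≤ B₃)
    (hg : 0 ≤ g) (hpg : 0 ≤ pg) (hdist : ∀ x y, 0 ≤ X.dist x y)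
    (h43 : Shape43M X f κ₁ M₁ ℓ C) (hK1a : Shape43CauchyM X f f' κ₁ M₁ ℓ C δ)
    (h44 : Loop44 X B ℓ L B₃ g pg) (h44' : Loop44 X B' ℓ L B₃ g pg) (hcfg : Loop44Cauchy X B B' ℓ L B₃ g pg δB) :
    Bound44 X (fun y n c => evalTerm X f' B' y n c - evalTerm X f B y n c) κ₁ M₁ ℓ L (2 * B₃) g pg (C * (δ + δB)) := by
  classical
  intro y n c
  -- abbreviations
  set F := f y n c with hF
  set F' := f' y n c with hF'
  set m : Fin n → E := fun i => B y (c i) with hm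
  set m' : Fin n → E := fun i => B' y (c i) with hm'
  have he0 : ∀ i, 0 ≤ legDecay X κ₁ M₁ ℓ y (c i) := fun i => (legDecay_pos X κ₁ M₁ ℓ y (c i)).le
  have hs0 : ∀ i, 0 ≤ legSize X ℓ L B₃ g pg y (c i) := fun i => legSize_nonneg X hℓ hB hg hpg hdist y (c i)
  have hPe : 0 ≤ ∏ i, legDecay X κ₁ M₁ ℓ y (c i) := Finset.prod_nonneg fun i _ => he0 i
  have hPs : 0 ≤ ∏ i, legSize X ℓ L B₃ g pg y (c i) := Finset.prod_nonneg fun i _ => hs0 i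
  -- (a) the kernel-difference term `(F' − F) m'`
  have hA : ‖(F' - F) m'‖ ≤ (C * δ * ∏ i, legDecay X κ₁ M₁ ℓ y (c i)) * ∏ i, legSize X ℓ L B₃ g pg y (c i) := by
    calc ‖(F' - F) m'‖ ≤ ‖F' - F‖ * ∏ i, ‖m' i‖ := (F' - F).le_opNorm m'
      _ ≤ (C * δ * ∏ i, legDecay X κ₁ M₁ ℓ y (c i)) * ∏ i, legSize X ℓ L B₃ g pg y (c i) := by
          apply mul_le_mul (hK1a y n c) (Finset.prod_le_prod (fun i _ => norm_nonneg _) fun i _ => h44' y (c i))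
            (Finset.prod_nonneg fun i _ => norm_nonneg _)
          exact mul_nonneg (mul_nonneg hC hδ) hPe
  -- (b) the configuration-difference term `F m' − F m` (telescoping over legs)
  have hleg : ∀ i : Fin n, (∏ j, if j = i then ‖m' i - m i‖ else max ‖m' j‖ ‖m j‖) ≤
      δB * ∏ j, legSize X ℓ L B₃ g pg y (c j) := by
    intro i
    calc (∏ j, if j = i then ‖m' i - m i‖ else max ‖m' j‖ ‖m j‖)
        ≤ ∏ j, ((if j = i then δB else 1) * legSize X ℓ L B₃ g pg y (c j)) := by
          refine Finset.prod_le_prod (fun j _ => ?_) fun j _ => ?_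
          · split_ifs
            · exact norm_nonneg _
            · exact le_max_of_le_left (norm_nonneg _)
          · by_cases hj : j = i
            · subst hj
              simpa using hcfg y (c j)
            · simpa [hj] using max_le (h44' y (c j)) (h44 y (c j))
      _ = (∏ j, (if j = i then δB else (1 : ℝ))) * ∏ j, legSize X ℓ L B₃ g pg y (c j) := Finset.prod_mul_distrib
      _ = δB * ∏ j, legSize X ℓ L B₃ g pg y (c j) := by simp
  have hB' : ‖F m' - F m‖ ≤ (C * ∏ i, legDecay X κ₁ M₁ ℓ y (c i)) * (n * (δB * ∏ j, legSize X ℓ L B₃ g pg y (c j))) := by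
    calc ‖F m' - F m‖ ≤ ‖F‖ * ∑ i, ∏ j, (if j = i then ‖m' i - m i‖ else max ‖m' j‖ ‖m j‖) :=
          F.norm_image_sub_le' m' m
      _ ≤ (C * ∏ i, legDecay X κ₁ M₁ ℓ y (c i)) * ∑ _i : Fin n, δB * ∏ j, legSize X ℓ L B₃ g pg y (c j) := by
          apply mul_le_mul (h43.2 y n c) (Finset.sum_le_sum fun i _ => hleg i)
            (Finset.sum_nonneg fun i _ => Finset.prod_nonneg fun j _ => ?_) (mul_nonneg hC hPe)
          split_ifs
          · exact norm_nonneg _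
          · exact le_max_of_le_left (norm_nonneg _)
      _ = (C * ∏ i, legDecay X κ₁ M₁ ℓ y (c i)) * (n * (δB * ∏ j, legSize X ℓ L B₃ g pg y (c j))) := by
          rw [Finset.sum_const, Finset.card_univ, Fintype.card_fin, nsmul_eq_mul]
  -- (c) assemble
  have hsplit : evalTerm X f' B' y n c - evalTerm X f B y n c = (F' - F) m' + (F m' - F m) := by
    rw [sub_apply]
    show F' m' - F m = F' m' - F m' + (F m' - F m)
    ring
  have hprod : ∏ i, factor44 X κ₁ M₁ ℓ L (2 * B₃) g pg y (c i) =
      2 ^ n * ((∏ i, legDecay X κ₁ M₁ ℓ y (c i)) * ∏ i, legSize X ℓ L B₃ g pg y (c i)) := by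
    rw [← Finset.prod_mul_distrib]
    simp_rw [factor44_two_mul, factor44_eq]
    rw [Finset.prod_mul_distrib, Finset.prod_const, Finset.card_univ, Fintype.card_fin]
  show |evalTerm X f' B' y n c - evalTerm X f B y n c| ≤
    C * (δ + δB) * ∏ i, factor44 X κ₁ M₁ ℓ L (2 * B₃) g pg y (c i)
  rw [hsplit, hprod]
  calc |(F' - F) m' + (F m' - F m)| ≤ ‖(F' - F) m'‖ + ‖F m' - F m‖ := by
        simpa only [Real.norm_eq_abs] using norm_add_le ((F' - F) m') (F m' - F m)
    _ ≤ (C * δ * ∏ i, legDecay X κ₁ M₁ ℓ y (c i)) * ∏ i, legSize X ℓ L B₃ g pg y (c i) +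
          (C * ∏ i, legDecay X κ₁ M₁ ℓ y (c i)) * (n * (δB * ∏ j, legSize X ℓ L B₃ g pg y (c j))) :=
        add_le_add hA hB'
    _ = C * (δ + n * δB) * ((∏ i, legDecay X κ₁ M₁ ℓ y (c i)) * ∏ i, legSize X ℓ L B₃ g pg y (c i)) := by ring
    _ ≤ C * (2 ^ n * (δ + δB)) * ((∏ i, legDecay X κ₁ M₁ ℓ y (c i)) * ∏ i, legSize X ℓ L B₃ g pg y (c i)) := by
        apply mul_le_mul_of_nonneg_right _ (mul_nonneg hPe hPs)
        exact mul_le_mul_of_nonneg_left (rate_legCount_le n hδ hδB) hC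
    _ = C * (δ + δB) * (2 ^ n * ((∏ i, legDecay X κ₁ M₁ ℓ y (c i)) * ∏ i, legSize X ℓ L B₃ g pg y (c i))) := by
        ring

/-- The difference family inherits the degree floor `n ≥ 2` of (43). -/
theorem floor_twoRun (X : VertexGeometry) (f f' : CoeffMaps X E) (B B' : LoopVars X E) {κ₁ M₁ ℓ C C' : ℝ}
    (h43 : Shape43M X f κ₁ M₁ ℓ C) (h43' : Shape43M X f' κ₁ M₁ ℓ C') :
    ∀ (y : X.Site) (n : ℕ) (c : Fin n → X.Bond),
      evalTerm X f' B' y n c - evalTerm X f B y n c ≠ 0 → 2 ≤ n := by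
  intro y n c hne
  by_contra hn
  have hf : f y n c = 0 := by
    by_contra h
    exact hn (h43.1 y n c h)
  have hf' : f' y n c = 0 := by
    by_contra h
    exact hn (h43'.1 y n c h)
  exact hne (by simp [evalTerm, hf, hf'])

/-! ## §5 (45) and (46) BY NAME for the difference family: rate × θ₀² × volume, profile `p₀`, no polylog -/

/-- **Two-run (45)** (per block): `Σ_{Y_j : y = y₀} |𝒫'_j(Y_j,U'_k) − 𝒫_j(Y_j,U_k)| ≤ 2C(δ+δB)·(16L²B₃Z·g p(g))²·ℓ⁴`,
uniformly in the degree cut-off `N`, under the smallness `8L²(2B₃)Z·g p(g)·ℓ² ≤ ½` (a `γ`-window).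
`bound45_of_bound44` by name. -/
theorem bound45_twoRun (X : VertexGeometry) (f f' : CoeffMaps X E) (B B' : LoopVars X E)
    (adm : X.Site → Finset X.Bond) (N : ℕ)
    {κ₁ M₁ ℓ L B₃ g pg C C' δ δB Z : ℝ} (hC : 0 ≤ C) (hδ : 0 ≤ δ) (hδB : 0 ≤ δB) (hℓ : 0 < ℓ) (hB : 0 ≤ B₃)
    (hg : 0 ≤ g) (hpg : 0 ≤ pg) (hdist : ∀ x y, 0 ≤ X.dist x y)
    (h43 : Shape43M X f κ₁ M₁ ℓ C) (h43' : Shape43M X f' κ₁ M₁ ℓ C') (hK1a : Shape43CauchyM X f f' κ₁ M₁ ℓ C δ)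
    (h44 : Loop44 X B ℓ L B₃ g pg) (h44' : Loop44 X B' ℓ L B₃ g pg) (hcfg : Loop44Cauchy X B B' ℓ L B₃ g pg δB)
    (hZ : ∀ y₀ : X.Site, ∑ b ∈ adm y₀,
      Real.exp (-(κ₁ * (M₁ * ℓ)⁻¹ * X.dist (X.cminus b) y₀)) * (ℓ⁻¹ * X.dist (X.cminus b) y₀) ≤ Z)
    (hsmall : 8 * L ^ 2 * (2 * B₃) * Z * g * pg * ℓ ^ 2 ≤ 1 / 2) :
    Bound45 X (blockSum45 X (fun y n c => evalTerm X f' B' y n c - evalTerm X f B y n c) adm N)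
      (8 * L ^ 2 * (2 * B₃) * Z) g pg ℓ (2 * (C * (δ + δB))) :=
  bound45_of_bound44 X _ adm N (mul_nonneg hC (add_nonneg hδ hδB)) hℓ (by positivity) hg hpg hdist
    (bound44_twoRun X f f' B B' hC hδ hδB hℓ hB hg hpg hdist h43 hK1a h44 h44' hcfg)
    (floor_twoRun X f f' B B' h43 h43') hZ hsmall

/-- **Two-run (46)** (summed over blocks and levels `j = 1, …, k`, `ℓ_j = L^{−(k−j)}`): total discrepancy of the
leg-currency families in a region `≤ 2C(δ+δB)·(16L²B₃Z)²·M₁⁻³·(L/(L−1))·(g p(g))²·|Λ_k|` — RATE × θ₀² × VOLUME at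
profile `p₀`: the rate half of `GlobalSupRateTSlack` (3⁗) once `δ + δB = O(L^{−a(K−n)})`.  `bound46_of_bound45` by
name over per-level difference families `Δ j`. -/
theorem bound46_twoRun (X : VertexGeometry) (k : ℕ) (blocks : ℕ → Finset X.Site) (Δ : ℕ → TermSizes X)
    (adm : X.Site → Finset X.Bond) (N : ℕ) (ℓ : ℕ → ℝ) {L M₁ B₃ Z g pg C δ δB Λvol : ℝ}
    (hL : 1 < L) (hM : 0 < M₁) (hC : 0 ≤ C) (hδ : 0 ≤ δ) (hδB : 0 ≤ δB) (hΛ : 0 ≤ Λvol)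
    (hℓ : ∀ j ∈ Finset.Icc 1 k, ℓ j = L⁻¹ ^ (k - j))
    (h45 : ∀ j ∈ Finset.Icc 1 k,
      Bound45 X (blockSum45 X (Δ j) adm N) (8 * L ^ 2 * (2 * B₃) * Z) g pg (ℓ j) (2 * (C * (δ + δB))))
    (hcard : ∀ j ∈ Finset.Icc 1 k, ((blocks j).card : ℝ) ≤ (M₁ * ℓ j)⁻¹ ^ 3 * Λvol) :
    ∑ j ∈ Finset.Icc 1 k, ∑ y ∈ blocks j, blockSum45 X (Δ j) adm N y ≤
      2 * (C * (δ + δB)) * (8 * L ^ 2 * (2 * B₃) * Z) ^ 2 * M₁⁻¹ ^ 3 * (L / (L - 1)) * (g * pg) ^ 2 * Λvol :=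
  bound46_of_bound45 X k blocks (fun j => blockSum45 X (Δ j) adm N) ℓ hL hM
    (mul_nonneg (by norm_num) (mul_nonneg hC (add_nonneg hδ hδB))) hΛ hℓ h45 hcard

/-! ## §6 Orders `> N`: sized, not compared — the slack half `θ₀^7` (σ = 7 ∈ ℕ, profile `p₀`) -/

/-- Shape of the full two-run estimate: if each run's term is (compared part) + (remainder), the discrepancy is bounded
by the compared discrepancy (RATE half, §5) plus the two remainders' SIZES ((57): `(g p(g))⁷` each — the SLACK half
with `σ = 7`).  Triangle inequality. [cite: Balaban1985UV3, (57) p.270] -/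
theorem twoRun_rate_add_slack {S S' R R' rate slack : ℝ} (hS : |S' - S| ≤ rate) (hR : |R| ≤ slack)
    (hR' : |R'| ≤ slack) : |(S' + R') - (S + R)| ≤ rate + 2 * slack := by
  have h : (S' + R') - (S + R) = (S' - S) + R' + (-R) := by ring
  rw [h]
  calc |(S' - S) + R' + (-R)| ≤ |(S' - S) + R'| + |(-R)| := abs_add_le _ _
    _ ≤ |S' - S| + |R'| + |(-R)| := by linarith [abs_add_le (S' - S) R']
    _ ≤ rate + slack + slack := by rw [abs_neg]; linarith
    _ = rate + 2 * slack := by ring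

/-- Currency check of the two halves against 3⁗ (`GlobalSupRateTSlack … a σ C`): with `θ = g·p(g)` (profile `p₀`),
rate `δ + δB ≤ Cr·r` (`r = ((L:ℝ)^(K−n))⁻¹ ^ a`) and volume `V = |Λ|`, a bound `A·(δ+δB)·θ²·V + 2·(Cs·V·θ^7)` is of
the form `C·V·(θ²·r + θ^7)` with `C = max (A·Cr) (2·Cs)` — uniform in whatever `A, Cr, Cs` are uniform in
(here: `K, n`).  Real arithmetic. -/
theorem currency_3quad {A Cr Cs δ δB θ r V : ℝ} (hA : 0 ≤ A) (hθ : 0 ≤ θ) (hV : 0 ≤ V)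
    (hr : 0 ≤ r) (hrate : δ + δB ≤ Cr * r) :
    A * (δ + δB) * θ ^ 2 * V + 2 * (Cs * V * θ ^ 7) ≤ max (A * Cr) (2 * Cs) * V * (θ ^ 2 * r + θ ^ 7) := by
  have h1 : A * (δ + δB) * θ ^ 2 * V ≤ max (A * Cr) (2 * Cs) * V * (θ ^ 2 * r) := by
    calc A * (δ + δB) * θ ^ 2 * V ≤ A * (Cr * r) * θ ^ 2 * V := by
          apply mul_le_mul_of_nonneg_right _ hV
          apply mul_le_mul_of_nonneg_right _ (sq_nonneg θ)
          exact mul_le_mul_of_nonneg_left hrate hA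
      _ = (A * Cr) * V * (θ ^ 2 * r) := by ring
      _ ≤ max (A * Cr) (2 * Cs) * V * (θ ^ 2 * r) := by
          apply mul_le_mul_of_nonneg_right _ (mul_nonneg (sq_nonneg θ) hr)
          exact mul_le_mul_of_nonneg_right (le_max_left _ _) hV
  have h2 : 2 * (Cs * V * θ ^ 7) ≤ max (A * Cr) (2 * Cs) * V * θ ^ 7 := by
    calc 2 * (Cs * V * θ ^ 7) = (2 * Cs) * V * θ ^ 7 := by ring
      _ ≤ max (A * Cr) (2 * Cs) * V * θ ^ 7 := by
          apply mul_le_mul_of_nonneg_right _ (pow_nonneg hθ 7)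
          exact mul_le_mul_of_nonneg_right (le_max_right _ _) hV
  calc A * (δ + δB) * θ ^ 2 * V + 2 * (Cs * V * θ ^ 7)
      ≤ max (A * Cr) (2 * Cs) * V * (θ ^ 2 * r) + max (A * Cr) (2 * Cs) * V * θ ^ 7 := add_le_add h1 h2
    _ = max (A * Cr) (2 * Cs) * V * (θ ^ 2 * r + θ ^ 7) := by ring

end

end Summit.QuantumFields.YangMills.Cruxes.FluctuationComparisonRegPr.Ideate1LegCurrency
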